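import Summits.ValiantsHypothesis.ValiantsHypothesis.Theorems.BarrierLeverPartitionMinorsChowDoubleStepDet
import Summits.ValiantsHypothesis.ValiantsHypothesis.Theorems.BarrierLeverPartitionMinorsChowEdgeStep

/-!
# Route BarrierLever — Chow witnesses for partition minors (item 20172, CPM): determinant algebra of
# the TWO-EDGE STEP (a row coordinate with two edges against a column coordinate with two edges)

Helper file (`--supports stmt-ValiantsHypothesis-20172`; cell valiant-natproofs, rung V4, 𝒟-side of
door (c); seat val-np-p4 gen 13).  Closes NO item; pure matrix algebra consumed by `…ChowTwoEdgeStep`.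
Conventions of items 19717 / 20172 / 20195: a layout `(u, w)` of height `h` is HIT when some product
of `h + h` affine forms has nonsingular partition minor `det[coeff_{E (u i) (w j)} ∏ ℓ]`.

**The two-edge step (`chow_twoEdgeStep`, next file).**  Height `h + 1`, size `r + 2`.  The rows carry TWO
edges in direction `a` (`u v₁ = u v₀ ∪ a`, `u v₂ = u v₀' ∪ a`, `v₂ = v₁.succAbove v₂''`) and the
columns TWO edges in direction `c` (`w j₁ = w j₀ ∪ c`, `w j₂ = w j₀' ∪ c`); class sizes arbitrary.
If ONE product of `h + h` affine forms hits both the reduced layout (drop rows `v₁, v₂` and columns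
`j₁, j₂`; delete `a`, `c`; pull back) and the `2 × 2` base layout `(u v₀, u v₀') × (w j₀, w j₀')`
— which is the case as soon as each of the two is hit (`exists_common_chow_witness₂`) — then
`(u, w)` is hit.  This is the `m = 2` member of the family «`a` with exactly `m` row edges against
`c` with exactly `m` column edges» whose `m = 1` member is the edge step (`chow_edgeStep`); in the
engine it forbids, for a minimal unhit layout, any common nonzero value of the two EDGE-COUNT
profiles.  Census (kit, exact): it applies to `16 992` of the `21 600` `(4,7)` cores (all of which
survive the leaf/edge/double steps — the six «two squares through a point» row classes carry exactly
two edges in every direction) and to `2 640` of the `6 512` `(4,6)` survivors.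

Proof: gadget `g_t = (1 + x_a + (1−t) y_c)(1 + t y_c)`, `M(t) i j = t^{[a∈u i][c∈w j]} F i j`
(`coeff_partitionExpo_mul_pairFactor`); over `ℂ[X]` the two row operations `v₁ − v₀`, `v₂ − v₀'`
factor `(X − 1)²` (`det_twoEdgeMatrix_eq`); at `X = 1`, subtracting column `j₀` from `j₁` and `j₀'`
from `j₂` leaves a block-triangular matrix whose corner is the `2 × 2` BASE MINOR of `F`
(`det_twoMasked_ne_zero`, via `exists_equivPairCompl` and `Matrix.det_fromBlocks_zero₂₁`); a
nonzero polynomial has a non-root off `1` (`exists_det_twoEdge_ne_zero`).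

WHAT THIS IS NOT: a reduction step; nothing on items 20172 / 20195 / 19717 themselves, on crux
stmt-ValiantsHypothesis-14610, or on `VP` versus `VNP`.
-/

set_option linter.dupNamespace false

namespace Summit.ValiantsHypothesis.ValiantsHypothesis.Theorems.BarrierLever.ChowFactor

open Finset MvPolynomial

noncomputable section

variable {h : ℕ}

/-! ## 1. Determinant algebra -/

/-- **Two masked rows against two doubled columns (base minor version).**  Replace the rows `v₁`,
`v₂ = v₁.succAbove v₂''` of `F` by `Q`-masked copies of the rows `v₀`, `v₀'`; if the columns
`j₁ = j₀`, `j₂ = j₀'` of `F` coincide (`j₂ = j₁.succAbove j₂''`, `Q j₁`, `Q j₂`, `¬Q j₀`, `¬Q j₀'`), the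
base minor `F[v₀,v₀' ; j₀,j₀']` is nonsingular and the minor off rows `v₁, v₂` and columns `j₁, j₂`
is nonsingular, then the masked matrix is nonsingular. -/
theorem det_twoMasked_ne_zero {n : ℕ} (F : Matrix (Fin (n + 2)) (Fin (n + 2)) ℂ)
    (Q : Fin (n + 2) → Prop) [DecidablePred Q] (v₀ v₀' v₁ : Fin (n + 2)) (v₂'' : Fin (n + 1))
    (j₀ j₀' j₁ : Fin (n + 2)) (j₂'' : Fin (n + 1))
    (hj₀ : j₀ ≠ j₁) (hj₀' : j₀' ≠ j₁) (hj₀'₂ : j₀' ≠ j₁.succAbove j₂'')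
    (hQ₁ : Q j₁) (hQ₂ : Q (j₁.succAbove j₂'')) (hQ₀ : ¬ Q j₀) (hQ₀' : ¬ Q j₀')
    (hcol₁ : ∀ i, F i j₁ = F i j₀) (hcol₂ : ∀ i, F i (j₁.succAbove j₂'') = F i j₀')
    (hbase : F v₀ j₀ * F v₀' j₀' - F v₀ j₀' * F v₀' j₀ ≠ 0)
    (hminor : (F.submatrix (fun k => v₁.succAbove (v₂''.succAbove k))
      (fun k => j₁.succAbove (j₂''.succAbove k))).det ≠ 0) :
    ((F.updateRow v₁ (fun j => (if Q j then (1 : ℂ) else 0) * F v₀ j)).updateRow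
      (v₁.succAbove v₂'') (fun j => (if Q j then (1 : ℂ) else 0) * F v₀' j)).det ≠ 0 := by
  classical
  set v₂ := v₁.succAbove v₂'' with hv₂
  set j₂ := j₁.succAbove j₂'' with hj₂
  have hv₁₂ : v₂ ≠ v₁ := Fin.succAbove_ne v₁ v₂''
  have hj₁₂ : j₂ ≠ j₁ := Fin.succAbove_ne j₁ j₂''
  set N : Matrix (Fin (n + 2)) (Fin (n + 2)) ℂ :=
    (F.updateRow v₁ (fun j => (if Q j then (1 : ℂ) else 0) * F v₀ j)).updateRow v₂
      (fun j => (if Q j then (1 : ℂ) else 0) * F v₀' j) with hN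
  have hNrest : ∀ i j, i ≠ v₁ → i ≠ v₂ → N i j = F i j := by
    intro i j h1 h2
    rw [hN, Matrix.updateRow_ne h2, Matrix.updateRow_ne h1]
  have hNv₁ : ∀ j, N v₁ j = (if Q j then (1 : ℂ) else 0) * F v₀ j := by
    intro j
    rw [hN, Matrix.updateRow_ne hv₁₂.symm, Matrix.updateRow_self]
  have hNv₂ : ∀ j, N v₂ j = (if Q j then (1 : ℂ) else 0) * F v₀' j := by
    intro j
    rw [hN, Matrix.updateRow_self]
  set N₁ : Matrix (Fin (n + 2)) (Fin (n + 2)) ℂ :=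
    N.updateCol j₁ (fun i => N i j₁ + (-1 : ℂ) • N i j₀) with hN₁
  set N₂ : Matrix (Fin (n + 2)) (Fin (n + 2)) ℂ :=
    N₁.updateCol j₂ (fun i => N₁ i j₂ + (-1 : ℂ) • N₁ i j₀') with hN₂
  have hdet₁ : N₁.det = N.det := Matrix.det_updateCol_add_smul_self N hj₀.symm (-1)
  have hdet₂ : N₂.det = N₁.det := Matrix.det_updateCol_add_smul_self N₁ hj₀'₂.symm (-1)
  have hN₁_of_ne : ∀ i j, j ≠ j₁ → N₁ i j = N i j := fun i j hj => by
    rw [hN₁, Matrix.updateCol_ne hj]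
  have hN₂_of_ne : ∀ i j, j ≠ j₁ → j ≠ j₂ → N₂ i j = N i j := fun i j h1 h2 => by
    rw [hN₂, Matrix.updateCol_ne h2, hN₁_of_ne i j h1]
  have hN₂_j₁ : ∀ i, N₂ i j₁ = N i j₁ - N i j₀ := fun i => by
    rw [hN₂, Matrix.updateCol_ne hj₁₂.symm, hN₁, Matrix.updateCol_self, smul_eq_mul]; ring
  have hN₂_j₂ : ∀ i, N₂ i j₂ = N i j₂ - N i j₀' := fun i => by
    rw [hN₂, Matrix.updateCol_self, hN₁_of_ne i j₂ hj₁₂, hN₁_of_ne i j₀' hj₀', smul_eq_mul]; ring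
  obtain ⟨er, her0, her1, herk⟩ := exists_equivPairCompl v₁ v₂''
  obtain ⟨ec, hec0, hec1, heck⟩ := exists_equivPairCompl j₁ j₂''
  set K : Matrix (Fin 2) (Fin 2) ℂ := !![F v₀ j₀, F v₀ j₀'; F v₀' j₀, F v₀' j₀'] with hK
  set S : Matrix (Fin 2) (Fin n) ℂ := Matrix.of fun x k => N₂ (er (Sum.inl x)) (ec (Sum.inr k)) with hS
  set R : Matrix (Fin n) (Fin n) ℂ := F.submatrix (fun k => v₁.succAbove (v₂''.succAbove k))
    (fun k => j₁.succAbove (j₂''.succAbove k)) with hR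
  have hrow_ne₁ : ∀ k : Fin n, v₁.succAbove (v₂''.succAbove k) ≠ v₁ := fun k => Fin.succAbove_ne v₁ _
  have hrow_ne₂ : ∀ k : Fin n, v₁.succAbove (v₂''.succAbove k) ≠ v₂ := fun k e =>
    Fin.succAbove_ne v₂'' k (Fin.succAbove_right_injective e)
  have hcol_ne₁ : ∀ k : Fin n, j₁.succAbove (j₂''.succAbove k) ≠ j₁ := fun k => Fin.succAbove_ne j₁ _
  have hcol_ne₂ : ∀ k : Fin n, j₁.succAbove (j₂''.succAbove k) ≠ j₂ := fun k e =>
    Fin.succAbove_ne j₂'' k (Fin.succAbove_right_injective e)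
  have two : ∀ z : Fin 2, z = 0 ∨ z = 1 := fun z => by
    rcases Fin.eq_zero_or_eq_succ z with hz | ⟨z', hz⟩
    · exact Or.inl hz
    · right; rw [hz, Fin.eq_zero z', Fin.succ_zero_eq_one]
  have hblock : N₂.submatrix er ec = Matrix.fromBlocks K S 0 R := by
    ext x y
    rcases x with x | k <;> rcases y with y | l
    · rw [Matrix.submatrix_apply, Matrix.fromBlocks_apply₁₁]
      rcases two x with rfl | rfl <;> rcases two y with rfl | rfl
      · rw [her0, hec0, hN₂_j₁, hNv₁, hNv₁, hcol₁ v₀, hK, if_pos hQ₁, if_neg hQ₀]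
        simp
      · rw [her0, hec1, ← hj₂, hN₂_j₂, hNv₁, hNv₁, hcol₂ v₀, hK, if_pos hQ₂, if_neg hQ₀']
        simp
      · rw [her1, ← hv₂, hec0, hN₂_j₁, hNv₂, hNv₂, hcol₁ v₀', hK, if_pos hQ₁, if_neg hQ₀]
        simp
      · rw [her1, ← hv₂, hec1, ← hj₂, hN₂_j₂, hNv₂, hNv₂, hcol₂ v₀', hK, if_pos hQ₂, if_neg hQ₀']
        simp
    · rw [Matrix.submatrix_apply, Matrix.fromBlocks_apply₁₂, hS, Matrix.of_apply]
    · rw [Matrix.submatrix_apply, Matrix.fromBlocks_apply₂₁, Matrix.zero_apply, herk]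
      rcases two y with rfl | rfl
      · rw [hec0, hN₂_j₁, hNrest _ _ (hrow_ne₁ k) (hrow_ne₂ k), hNrest _ _ (hrow_ne₁ k) (hrow_ne₂ k),
          hcol₁, sub_self]
      · rw [hec1, ← hj₂, hN₂_j₂, hNrest _ _ (hrow_ne₁ k) (hrow_ne₂ k),
          hNrest _ _ (hrow_ne₁ k) (hrow_ne₂ k), hcol₂, sub_self]
    · rw [Matrix.submatrix_apply, Matrix.fromBlocks_apply₂₂, herk, heck, hR, Matrix.submatrix_apply,
        hN₂_of_ne _ _ (hcol_ne₁ l) (hcol_ne₂ l), hNrest _ _ (hrow_ne₁ k) (hrow_ne₂ k)]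
  have hKne : K.det ≠ 0 := by
    rw [hK, Matrix.det_fin_two_of]
    exact hbase
  have hsub : (N₂.submatrix er ec).det ≠ 0 := by
    rw [hblock, Matrix.det_fromBlocks_zero₂₁]
    exact mul_ne_zero hKne hminor
  have hN₂ne : N₂.det ≠ 0 := by
    intro hA
    apply hsub
    have e : N₂.submatrix er ec = (N₂.submatrix id (er.symm.trans ec)).submatrix er er := by
      ext x y; simp [Matrix.submatrix_apply]
    rw [e, Matrix.det_submatrix_equiv_self, Matrix.det_permute', hA, mul_zero]
  rwa [hdet₂, hdet₁] at hN₂ne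

/-- **Two row edges in one direction ⇒ a factor `(X − 1)²`.** -/
theorem det_twoEdgeMatrix_eq {n : ℕ} (F : Matrix (Fin (n + 2)) (Fin (n + 2)) ℂ)
    (P Q : Fin (n + 2) → Prop) [DecidablePred P] [DecidablePred Q] (v₀ v₀' v₁ v₂ : Fin (n + 2))
    (h10 : v₁ ≠ v₀) (h20 : v₂ ≠ v₀') (h12 : v₂ ≠ v₁)
    (hP₁ : P v₁) (hP₀ : ¬ P v₀) (hP₂ : P v₂) (hP₀' : ¬ P v₀')
    (hrow₁ : ∀ j, F v₁ j = F v₀ j) (hrow₂ : ∀ j, F v₂ j = F v₀' j) :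
    (Matrix.of fun i j => Polynomial.C (F i j) *
        (if P i ∧ Q j then (Polynomial.X : Polynomial ℂ) else 1)).det =
      (Polynomial.X - 1) ^ 2 *
        (((Matrix.of fun i j => Polynomial.C (F i j) *
            (if P i ∧ Q j then (Polynomial.X : Polynomial ℂ) else 1)).updateRow v₁
            (fun j => (if Q j then (1 : Polynomial ℂ) else 0) * Polynomial.C (F v₀ j))).updateRow v₂
            (fun j => (if Q j then (1 : Polynomial ℂ) else 0) * Polynomial.C (F v₀' j))).det := by
  classical
  set M : Matrix (Fin (n + 2)) (Fin (n + 2)) (Polynomial ℂ) := Matrix.of fun i j =>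
    Polynomial.C (F i j) * (if P i ∧ Q j then (Polynomial.X : Polynomial ℂ) else 1) with hM
  set ρ₁ : Fin (n + 2) → Polynomial ℂ := fun j =>
    (if Q j then (1 : Polynomial ℂ) else 0) * Polynomial.C (F v₀ j) with hρ₁
  set ρ₂ : Fin (n + 2) → Polynomial ℂ := fun j =>
    (if Q j then (1 : Polynomial ℂ) else 0) * Polynomial.C (F v₀' j) with hρ₂
  have hop₁ := Matrix.det_updateRow_add_smul_self M h10 (-1)
  have hrow₁' : M v₁ + (-1 : Polynomial ℂ) • M v₀ = ((Polynomial.X : Polynomial ℂ) - 1) • ρ₁ := by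
    ext j
    simp only [Pi.add_apply, Pi.smul_apply, smul_eq_mul, hM, Matrix.of_apply, hrow₁ j, hρ₁, hP₁, hP₀,
      true_and, false_and, if_false]
    by_cases hq : Q j
    · rw [if_pos hq, if_pos hq]; ring
    · rw [if_neg hq, if_neg hq]; ring
  rw [hrow₁', Matrix.det_updateRow_smul] at hop₁
  set M' := M.updateRow v₁ ρ₁ with hM'
  have h0'1 : v₀' ≠ v₁ := fun e => hP₀' (e ▸ hP₁)
  have hv₀' : M' v₀' = M v₀' := by
    ext j; rw [hM', Matrix.updateRow_ne h0'1]
  have hv₂' : M' v₂ = M v₂ := by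
    ext j; rw [hM', Matrix.updateRow_ne h12]
  have hop₂ := Matrix.det_updateRow_add_smul_self M' h20 (-1)
  have hrow₂' : M' v₂ + (-1 : Polynomial ℂ) • M' v₀' = ((Polynomial.X : Polynomial ℂ) - 1) • ρ₂ := by
    rw [hv₀', hv₂']
    ext j
    simp only [Pi.add_apply, Pi.smul_apply, smul_eq_mul, hM, Matrix.of_apply, hrow₂ j, hρ₂, hP₂, hP₀',
      true_and, false_and, if_false]
    by_cases hq : Q j
    · rw [if_pos hq, if_pos hq]; ring
    · rw [if_neg hq, if_neg hq]; ring
  rw [hrow₂', Matrix.det_updateRow_smul] at hop₂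
  rw [← hop₁, ← hop₂]
  ring

/-- **Two edges against two edges: some parameter works.** -/
theorem exists_det_twoEdge_ne_zero {n : ℕ} (F : Matrix (Fin (n + 2)) (Fin (n + 2)) ℂ)
    (P Q : Fin (n + 2) → Prop) [DecidablePred P] [DecidablePred Q] (v₀ v₀' v₁ : Fin (n + 2))
    (v₂'' : Fin (n + 1)) (j₀ j₀' j₁ : Fin (n + 2)) (j₂'' : Fin (n + 1))
    (hP₁ : P v₁) (hP₀ : ¬ P v₀) (hP₂ : P (v₁.succAbove v₂'')) (hP₀' : ¬ P v₀')
    (hrow₁ : ∀ j, F v₁ j = F v₀ j) (hrow₂ : ∀ j, F (v₁.succAbove v₂'') j = F v₀' j)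
    (hj₀ : j₀ ≠ j₁) (hj₀' : j₀' ≠ j₁) (hj₀'₂ : j₀' ≠ j₁.succAbove j₂'')
    (hQ₁ : Q j₁) (hQ₂ : Q (j₁.succAbove j₂'')) (hQ₀ : ¬ Q j₀) (hQ₀' : ¬ Q j₀')
    (hcol₁ : ∀ i, F i j₁ = F i j₀) (hcol₂ : ∀ i, F i (j₁.succAbove j₂'') = F i j₀')
    (hbase : F v₀ j₀ * F v₀' j₀' - F v₀ j₀' * F v₀' j₀ ≠ 0)
    (hminor : (F.submatrix (fun k => v₁.succAbove (v₂''.succAbove k))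
      (fun k => j₁.succAbove (j₂''.succAbove k))).det ≠ 0) :
    ∃ t : ℂ, (Matrix.of fun i j => (if P i ∧ Q j then t else 1) * F i j).det ≠ 0 := by
  classical
  set v₂ := v₁.succAbove v₂'' with hv₂
  have h12 : v₂ ≠ v₁ := Fin.succAbove_ne v₁ v₂''
  have h10 : v₁ ≠ v₀ := fun e => hP₀ (e ▸ hP₁)
  have h20 : v₂ ≠ v₀' := fun e => hP₀' (e ▸ hP₂)
  set M : Matrix (Fin (n + 2)) (Fin (n + 2)) (Polynomial ℂ) := Matrix.of fun i j =>
    Polynomial.C (F i j) * (if P i ∧ Q j then (Polynomial.X : Polynomial ℂ) else 1) with hM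
  set R₂ : Matrix (Fin (n + 2)) (Fin (n + 2)) (Polynomial ℂ) :=
    (M.updateRow v₁ (fun j => (if Q j then (1 : Polynomial ℂ) else 0) * Polynomial.C (F v₀ j))
      ).updateRow v₂ (fun j => (if Q j then (1 : Polynomial ℂ) else 0) * Polynomial.C (F v₀' j))
    with hR₂
  set D : Polynomial ℂ := R₂.det with hD
  have hfac : M.det = (Polynomial.X - 1) ^ 2 * D :=
    det_twoEdgeMatrix_eq F P Q v₀ v₀' v₁ v₂ h10 h20 h12 hP₁ hP₀ hP₂ hP₀' hrow₁ hrow₂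
  have heval : ∀ t : ℂ, (Polynomial.evalRingHom t).mapMatrix M =
      Matrix.of fun i j => (if P i ∧ Q j then t else 1) * F i j := by
    intro t
    ext i j
    simp only [RingHom.mapMatrix_apply, Matrix.map_apply, hM, Matrix.of_apply,
      Polynomial.coe_evalRingHom, Polynomial.eval_mul, Polynomial.eval_C]
    split_ifs <;> simp [mul_comm]
  have hD1 : Polynomial.eval 1 D ≠ 0 := by
    have e : (Polynomial.evalRingHom (1 : ℂ)).mapMatrix R₂ =
        (F.updateRow v₁ (fun j => (if Q j then (1 : ℂ) else 0) * F v₀ j)).updateRow v₂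
          (fun j => (if Q j then (1 : ℂ) else 0) * F v₀' j) := by
      ext i j
      by_cases hi : i = v₂
      · subst hi
        simp only [RingHom.mapMatrix_apply, Matrix.map_apply, hR₂, Matrix.updateRow_self,
          Polynomial.coe_evalRingHom]
        split_ifs <;> simp
      · by_cases hi' : i = v₁
        · subst hi'
          simp only [RingHom.mapMatrix_apply, Matrix.map_apply, hR₂, Matrix.updateRow_ne hi,
            Matrix.updateRow_self, Polynomial.coe_evalRingHom]
          split_ifs <;> simp
        · simp only [RingHom.mapMatrix_apply, Matrix.map_apply, hR₂, Matrix.updateRow_ne hi,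
            Matrix.updateRow_ne hi', hM, Matrix.of_apply, Polynomial.coe_evalRingHom,
            Polynomial.eval_mul, Polynomial.eval_C]
          split_ifs <;> simp
    have e2 : Polynomial.eval 1 D =
        ((F.updateRow v₁ (fun j => (if Q j then (1 : ℂ) else 0) * F v₀ j)).updateRow v₂
          (fun j => (if Q j then (1 : ℂ) else 0) * F v₀' j)).det := by
      rw [hD, ← Polynomial.coe_evalRingHom, RingHom.map_det, e]
    rw [e2]
    exact det_twoMasked_ne_zero F Q v₀ v₀' v₁ v₂'' j₀ j₀' j₁ j₂'' hj₀ hj₀' hj₀'₂ hQ₁ hQ₂ hQ₀ hQ₀'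
      hcol₁ hcol₂ hbase hminor
  have hD0 : D ≠ 0 := fun h0 => hD1 (by rw [h0, Polynomial.eval_zero])
  obtain ⟨t, ht⟩ := Infinite.exists_notMem_finset (insert (1 : ℂ) D.roots.toFinset)
  rw [Finset.mem_insert, not_or, Multiset.mem_toFinset, Polynomial.mem_roots hD0] at ht
  refine ⟨t, ?_⟩
  rw [← heval t, ← RingHom.map_det, hfac, Polynomial.coe_evalRingHom, Polynomial.eval_mul,
    Polynomial.eval_pow, Polynomial.eval_sub, Polynomial.eval_X, Polynomial.eval_one]
  exact mul_ne_zero (pow_ne_zero _ (sub_ne_zero.mpr ht.1)) ht.2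

end

end Summit.ValiantsHypothesis.ValiantsHypothesis.Theorems.BarrierLever.ChowFactor
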